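import Mathlib.Analysis.SpecialFunctions.Pow.Real
import Mathlib.Algebra.BigOperators.Intervals
import Mathlib.Algebra.Order.Floor.Defs
import Mathlib.Tactic
import HarnessLib

/-!
# The numerical part of Cafure–Matera's Theorem 5.2 for general degree (Prop. 4.1 in crude form)

Library file (theorems only, pure real arithmetic). In the proof of Thm. 5.2 of Cafure–Matera
(2006) the contribution of the plane sections that are not absolutely irreducible is bounded by
`q^{3n}` times the sum over `j = 1, …, δ-1` of the counts of Cor. 3.2 (`c₃₂ = 3δ⁴/2 - 2δ³ + 5δ²/2`)
and Cor. 3.4 with `D = D_j = ⌊δ/(j+1)⌋` (their Prop. 4.1, proved there by a page of calculus,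
(11)–(15), with the choice `r = δ^{1/3}`). Here we prove the analogous estimate for the CRUDE
degree bound `e(D) = 2δ² + 2δ² D (D+1)²` of a degree-`D` certificate built on the box space
`{deg_X ≤ D, deg_Y ≤ D}` with the trivial minor count (see the module docstrings of the tree's
`Bertini*Proofs` files):

* `sum_min_le_of_one_le`: for every `r ≥ 1`,
  `∑_{j=1}^{δ-1} min(c₃₂, e(D_j)) ≤ (r-1) c₃₂ + 2δ³ + 4δ⁵/r²` — head `j < r` by Cor. 3.2, tail by
  `e(D_j) ≤ 2δ² + 8δ⁵/(j+1)³` (`D_j ≥ 1`) and the telescoping bound `∑_{k>r} k⁻³ ≤ 1/(2r²)`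
  (`sum_Ico_inv_succ_pow_three_le`);
* `sum_min_le_rpow`: with `r = ⌊2δ^{1/3}⌋ + 1` this is `≤ 4δ^{13/3} + 2δ³` (`δ ≥ 2`);
* `numeric_main`: for `δ ≥ 9` and `Q > 5δ^{10/3}`,
  `(1 + δ + 4δ³)(Q-1) + Q(δ² + ∑_j min(c₃₂, e(D_j))) ≤ 5δ^{13/3}(Q-1)`, the inequality that closes
  (22) of the printed proof in the parametrised averaging form used in this tree (`Q = qᵐ`).

The constants are far from optimal (the printed `2δ^{13/3} + 3δ^{11/3}` becomes `4δ^{13/3} + 2δ³`),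
which the final constant `5δ^{13/3}` of Thm. 5.2 absorbs for `δ ≥ 9`; degrees `δ ≤ 8` are covered by
Cor. 3.2 alone (`CafureMateraThm52SmallDegreeProofs`).

## References

* A. Cafure, G. Matera, *Improved explicit estimates on the number of solutions of equations over a
  finite field*, Finite Fields Appl. 12 (2006) 155–185, Prop. 4.1, (11)–(15), (22).
  [CafureMatera2006]
-/

noncomputable section

open Finset

namespace Literature.NumberTheory.DiophantineGeometry

/-! ### A telescoping bound for `∑ 1/k³` -/

/-- `∑_{j=r}^{n-1} 1/(j+1)³ ≤ 1/(2r(r+1)) - 1/(2n(n+1))` for `1 ≤ r ≤ n` (telescoping with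
`1/k³ ≤ 1/((k-1)k(k+1))`). [folklore] -/
theorem sum_Ico_inv_succ_pow_three_le_sub {r : ℕ} (hr : 1 ≤ r) :
    ∀ n, r ≤ n → ∑ j ∈ Finset.Ico r n, (1 : ℝ) / ((j : ℝ) + 1) ^ 3 ≤
      1 / (2 * (r : ℝ) * ((r : ℝ) + 1)) - 1 / (2 * (n : ℝ) * ((n : ℝ) + 1)) := by
  refine Nat.le_induction ?_ fun n hn ih ↦ ?_
  · simp
  rw [Finset.sum_Ico_succ_top hn]
  have hn1 : (1 : ℝ) ≤ n := by exact_mod_cast hr.trans hn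
  have hstep : (1 : ℝ) / ((n : ℝ) + 1) ^ 3 ≤
      1 / (2 * (n : ℝ) * ((n : ℝ) + 1)) - 1 / (2 * ((n + 1 : ℕ) : ℝ) * (((n + 1 : ℕ) : ℝ) + 1)) := by
    push_cast
    rw [div_sub_div _ _ (by positivity) (by positivity), div_le_div_iff₀ (by positivity) (by positivity)]
    nlinarith [sq_nonneg (n : ℝ), mul_pos (show (0 : ℝ) < n by linarith) (show (0 : ℝ) < n + 1 by linarith)]
  linarith

/-- `∑_{j=r}^{n-1} 1/(j+1)³ ≤ 1/(2r²)` for `r ≥ 1` (any `n`). [folklore] -/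
theorem sum_Ico_inv_succ_pow_three_le {r : ℕ} (hr : 1 ≤ r) (n : ℕ) :
    ∑ j ∈ Finset.Ico r n, (1 : ℝ) / ((j : ℝ) + 1) ^ 3 ≤ 1 / (2 * (r : ℝ) ^ 2) := by
  rcases le_or_gt r n with hrn | hnr
  · refine (sum_Ico_inv_succ_pow_three_le_sub hr n hrn).trans ?_
    have hr1 : (1 : ℝ) ≤ r := by exact_mod_cast hr
    have hn1 : (1 : ℝ) ≤ n := by exact_mod_cast hr.trans hrn
    have h1 : (0 : ℝ) ≤ 1 / (2 * (n : ℝ) * ((n : ℝ) + 1)) := by positivity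
    have h2 : (1 : ℝ) / (2 * (r : ℝ) * ((r : ℝ) + 1)) ≤ 1 / (2 * (r : ℝ) ^ 2) :=
      one_div_le_one_div_of_le (by positivity) (by nlinarith)
    linarith
  · rw [Finset.Ico_eq_empty (by omega), Finset.sum_empty]
    positivity

/-! ### The summed graded count: head by Cor. 3.2, tail by the degree-`D` certificates -/

/-- **Head–tail splitting of `∑_j min(c₃₂, e(D_j))`.** For `δ ≥ 2` and any `r ≥ 1`,
`∑_{j=1}^{δ-1} min(c₃₂, e(⌊δ/(j+1)⌋)) ≤ (r-1) c₃₂ + 2δ³ + 4δ⁵/r²`, where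
`c₃₂ = (3δ⁴ + 5δ²)/2 - 2δ³` and `e(D) = 2δ² + 2δ² D(D+1)²`.
[cite: CafureMatera2006, Prop. 4.1 ((13)–(14), crude form)] -/
theorem sum_min_le_of_one_le {δ : ℕ} (hδ : 2 ≤ δ) {r : ℕ} (hr : 1 ≤ r) :
    ∑ j ∈ Finset.Icc 1 (δ - 1),
        min ((3 * (δ : ℝ) ^ 4 + 5 * (δ : ℝ) ^ 2) / 2 - 2 * (δ : ℝ) ^ 3)
          (2 * (δ : ℝ) ^ 2 + 2 * (δ : ℝ) ^ 2 * ((δ / (j + 1) : ℕ) : ℝ) * (((δ / (j + 1) : ℕ) : ℝ) + 1) ^ 2) ≤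
      ((r : ℝ) - 1) * ((3 * (δ : ℝ) ^ 4 + 5 * (δ : ℝ) ^ 2) / 2 - 2 * (δ : ℝ) ^ 3) +
        2 * (δ : ℝ) ^ 3 + 4 * (δ : ℝ) ^ 5 / (r : ℝ) ^ 2 := by
  set x : ℝ := (δ : ℝ) with hx
  set c : ℝ := (3 * x ^ 4 + 5 * x ^ 2) / 2 - 2 * x ^ 3 with hc
  set e : ℕ → ℝ := fun j ↦ 2 * x ^ 2 + 2 * x ^ 2 * ((δ / (j + 1) : ℕ) : ℝ) *
    (((δ / (j + 1) : ℕ) : ℝ) + 1) ^ 2 with he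
  have hx2 : (2 : ℝ) ≤ x := by rw [hx]; exact_mod_cast hδ
  have hc0 : 0 ≤ c := by
    have h' : 0 ≤ 3 * x ^ 2 - 4 * x + 5 := by nlinarith [sq_nonneg (x - 1)]
    have := mul_nonneg (sq_nonneg x) h'
    rw [hc]; nlinarith [this]
  -- pointwise: `min ≤ c` on the head, `min ≤ e_j ≤ 2x² + 8x⁵/(j+1)³` on the tail
  have hpt : ∀ j ∈ Finset.Icc 1 (δ - 1), min c (e j) ≤
      (if j < r then c else 0) + (if r ≤ j then 2 * x ^ 2 + 8 * x ^ 5 * (1 / ((j : ℝ) + 1) ^ 3) else 0) := by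
    intro j hj
    rw [Finset.mem_Icc] at hj
    by_cases hjr : j < r
    · rw [if_pos hjr, if_neg (not_le.2 hjr), add_zero]
      exact min_le_left _ _
    · rw [if_neg hjr, if_pos (not_lt.1 hjr), zero_add]
      refine (min_le_right _ _).trans ?_
      -- `1 ≤ D ≤ x/(j+1)`
      set D : ℕ := δ / (j + 1) with hD
      have hD1 : 1 ≤ D := by
        rw [hD, Nat.le_div_iff_mul_le (by omega)]; omega
      have hD1' : (1 : ℝ) ≤ D := by exact_mod_cast hD1
      have hDle : (D : ℝ) ≤ x / ((j : ℝ) + 1) := by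
        rw [hD, hx, le_div_iff₀ (by positivity)]
        exact_mod_cast Nat.div_mul_le_self δ (j + 1)
      have hj0 : (0 : ℝ) < (j : ℝ) + 1 := by positivity
      have hD3 : (D : ℝ) ^ 3 ≤ x ^ 3 / ((j : ℝ) + 1) ^ 3 := by
        rw [← div_pow]; exact pow_le_pow_left₀ (by positivity) hDle 3
      have h4 : (D : ℝ) * ((D : ℝ) + 1) ^ 2 ≤ 4 * (D : ℝ) ^ 3 := by
        have h2D : ((D : ℝ) + 1) ^ 2 ≤ (2 * D) ^ 2 := pow_le_pow_left₀ (by positivity) (by linarith) 2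
        calc (D : ℝ) * ((D : ℝ) + 1) ^ 2 ≤ D * (2 * D) ^ 2 := mul_le_mul_of_nonneg_left h2D (by positivity)
          _ = 4 * (D : ℝ) ^ 3 := by ring
      rw [he]
      have hx0 : (0 : ℝ) ≤ 2 * x ^ 2 := by positivity
      have := mul_le_mul_of_nonneg_left (h4.trans (by linarith [hD3] :
        4 * (D : ℝ) ^ 3 ≤ 4 * (x ^ 3 / ((j : ℝ) + 1) ^ 3))) hx0
      have e1 : 2 * x ^ 2 * (4 * (x ^ 3 / ((j : ℝ) + 1) ^ 3)) = 8 * x ^ 5 * (1 / ((j : ℝ) + 1) ^ 3) := by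
        ring
      nlinarith [this, e1]
  refine (Finset.sum_le_sum hpt).trans ?_
  rw [Finset.sum_add_distrib, ← Finset.sum_filter, ← Finset.sum_filter, Finset.sum_const,
    nsmul_eq_mul]
  -- head: at most `r - 1` terms
  have hhead : (((Finset.Icc 1 (δ - 1)).filter fun j ↦ j < r).card : ℝ) * c ≤ ((r : ℝ) - 1) * c := by
    refine mul_le_mul_of_nonneg_right ?_ hc0
    have hsub : ((Finset.Icc 1 (δ - 1)).filter fun j ↦ j < r) ⊆ Finset.Icc 1 (r - 1) := by
      intro j hj
      rw [Finset.mem_filter, Finset.mem_Icc] at hj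
      rw [Finset.mem_Icc]; omega
    have := Finset.card_le_card hsub
    rw [Nat.card_Icc] at this
    have hr1 : (1 : ℝ) ≤ r := by exact_mod_cast hr
    have : ((((Finset.Icc 1 (δ - 1)).filter fun j ↦ j < r).card : ℕ) : ℝ) ≤ ((r - 1 : ℕ) : ℝ) := by
      exact_mod_cast (this.trans (by omega))
    rwa [Nat.cast_sub hr, Nat.cast_one] at this
  -- tail: `2x²` at most `δ - 1 ≤ δ` times, and the telescoping sum
  have htail : ∑ j ∈ (Finset.Icc 1 (δ - 1)).filter (fun j ↦ r ≤ j),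
      (2 * x ^ 2 + 8 * x ^ 5 * (1 / ((j : ℝ) + 1) ^ 3)) ≤ 2 * x ^ 3 + 4 * x ^ 5 / (r : ℝ) ^ 2 := by
    rw [Finset.sum_add_distrib, Finset.sum_const, nsmul_eq_mul, ← Finset.mul_sum]
    have h1 : (((Finset.Icc 1 (δ - 1)).filter fun j ↦ r ≤ j).card : ℝ) * (2 * x ^ 2) ≤ 2 * x ^ 3 := by
      have : ((Finset.Icc 1 (δ - 1)).filter fun j ↦ r ≤ j).card ≤ δ :=
        (Finset.card_filter_le _ _).trans (by rw [Nat.card_Icc]; omega)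
      have : ((((Finset.Icc 1 (δ - 1)).filter fun j ↦ r ≤ j).card : ℕ) : ℝ) ≤ x := by
        rw [hx]; exact_mod_cast this
      nlinarith [pow_pos (show (0 : ℝ) < x by linarith) 2]
    have h2 : ∑ j ∈ (Finset.Icc 1 (δ - 1)).filter (fun j ↦ r ≤ j), (1 / ((j : ℝ) + 1) ^ 3) ≤
        1 / (2 * (r : ℝ) ^ 2) := by
      refine le_trans ?_ (sum_Ico_inv_succ_pow_three_le hr δ)
      refine Finset.sum_le_sum_of_subset_of_nonneg (fun j hj ↦ ?_) (fun j _ _ ↦ by positivity)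
      rw [Finset.mem_filter, Finset.mem_Icc] at hj
      rw [Finset.mem_Ico]; omega
    have h3 : 8 * x ^ 5 * ∑ j ∈ (Finset.Icc 1 (δ - 1)).filter (fun j ↦ r ≤ j),
        (1 / ((j : ℝ) + 1) ^ 3) ≤ 4 * x ^ 5 / (r : ℝ) ^ 2 := by
      have hx5 : (0 : ℝ) ≤ 8 * x ^ 5 := by positivity
      refine (mul_le_mul_of_nonneg_left h2 hx5).trans (le_of_eq ?_)
      have hr0 : (r : ℝ) ≠ 0 := by exact_mod_cast (by omega : r ≠ 0)
      field_simp
      ring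
    linarith
  linarith

/-! ### Conversion to real powers -/

/-- `δ^{13/3} = δ⁴ · δ^{1/3}` and `δ^{10/3} = δ³ · δ^{1/3}` (`δ > 0`). [folklore] -/
theorem rpow_thirteen_thirds_eq {x : ℝ} (hx : 0 < x) :
    x ^ ((13 : ℝ) / 3) = x ^ 4 * x ^ ((3 : ℝ)⁻¹) ∧ x ^ ((10 : ℝ) / 3) = x ^ 3 * x ^ ((3 : ℝ)⁻¹) := by
  constructor
  · rw [show (13 : ℝ) / 3 = ((4 : ℕ) : ℝ) + (3 : ℝ)⁻¹ by norm_num, Real.rpow_add hx, Real.rpow_natCast]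
  · rw [show (10 : ℝ) / 3 = ((3 : ℕ) : ℝ) + (3 : ℝ)⁻¹ by norm_num, Real.rpow_add hx, Real.rpow_natCast]

/-- The cube of `δ^{1/3}` (`δ ≥ 0`). [folklore] -/
theorem rpow_third_pow_three {x : ℝ} (hx : 0 ≤ x) : (x ^ ((3 : ℝ)⁻¹)) ^ 3 = x := by
  rw [show ((3 : ℝ)⁻¹) = ((3 : ℕ) : ℝ)⁻¹ by norm_num]
  exact Real.rpow_inv_natCast_pow hx (by norm_num)

/-- **The summed graded count is at most `4δ^{13/3} + 2δ³`** (`δ ≥ 2`), choosing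
`r = ⌊2δ^{1/3}⌋ + 1` in `sum_min_le_of_one_le`: the head is `≤ 2δ^{1/3} · (3/2)δ⁴` and the tail
`≤ 2δ³ + 4δ⁵/(2δ^{1/3})²`. [cite: CafureMatera2006, Prop. 4.1 (crude form)] -/
theorem sum_min_le_rpow {δ : ℕ} (hδ : 2 ≤ δ) :
    ∑ j ∈ Finset.Icc 1 (δ - 1),
        min ((3 * (δ : ℝ) ^ 4 + 5 * (δ : ℝ) ^ 2) / 2 - 2 * (δ : ℝ) ^ 3)
          (2 * (δ : ℝ) ^ 2 + 2 * (δ : ℝ) ^ 2 * ((δ / (j + 1) : ℕ) : ℝ) * (((δ / (j + 1) : ℕ) : ℝ) + 1) ^ 2) ≤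
      4 * (δ : ℝ) ^ ((13 : ℝ) / 3) + 2 * (δ : ℝ) ^ 3 := by
  set x : ℝ := (δ : ℝ) with hx
  have hx2 : (2 : ℝ) ≤ x := by rw [hx]; exact_mod_cast hδ
  have hx0 : 0 < x := by linarith
  set t : ℝ := x ^ ((3 : ℝ)⁻¹) with ht
  have ht0 : 0 < t := Real.rpow_pos_of_pos hx0 _
  have ht3 : t ^ 3 = x := rpow_third_pow_three hx0.le
  have h13 : x ^ ((13 : ℝ) / 3) = x ^ 4 * t := by rw [ht]; exact (rpow_thirteen_thirds_eq hx0).1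
  -- `t ≥ 1`
  have ht1 : 1 ≤ t := by
    by_contra h
    rw [not_le] at h
    have : t ^ 3 < 1 := by
      calc t ^ 3 < 1 ^ 3 := pow_lt_pow_left₀ h ht0.le (by norm_num)
        _ = 1 := one_pow 3
    linarith
  set r : ℕ := ⌊2 * t⌋₊ + 1 with hr
  have hr1 : 1 ≤ r := by omega
  have hrle : (r : ℝ) - 1 ≤ 2 * t := by
    rw [hr]; push_cast
    linarith [Nat.floor_le (show (0 : ℝ) ≤ 2 * t by positivity)]
  have hrgt : 2 * t < r := by
    rw [hr]; push_cast
    exact Nat.lt_floor_add_one _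
  have hmain := sum_min_le_of_one_le hδ hr1
  -- head: `(r-1) c ≤ 2t · (3/2) x⁴`
  have hc32 : (3 * x ^ 4 + 5 * x ^ 2) / 2 - 2 * x ^ 3 ≤ 3 / 2 * x ^ 4 := by
    nlinarith [pow_pos hx0 2, mul_pos hx0 hx0]
  have hc0 : 0 ≤ (3 * x ^ 4 + 5 * x ^ 2) / 2 - 2 * x ^ 3 := by nlinarith [pow_pos hx0 2]
  have hhead : ((r : ℝ) - 1) * ((3 * x ^ 4 + 5 * x ^ 2) / 2 - 2 * x ^ 3) ≤ 3 * (x ^ 4 * t) := by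
    calc ((r : ℝ) - 1) * ((3 * x ^ 4 + 5 * x ^ 2) / 2 - 2 * x ^ 3)
        ≤ (2 * t) * ((3 * x ^ 4 + 5 * x ^ 2) / 2 - 2 * x ^ 3) := mul_le_mul_of_nonneg_right hrle hc0
      _ ≤ (2 * t) * (3 / 2 * x ^ 4) := mul_le_mul_of_nonneg_left hc32 (by positivity)
      _ = 3 * (x ^ 4 * t) := by ring
  -- tail: `4 x⁵ / r² ≤ x⁵ / t² = x⁴ t`
  have htail : 4 * x ^ 5 / (r : ℝ) ^ 2 ≤ x ^ 4 * t := by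
    have hr0 : (0 : ℝ) < r := by exact_mod_cast (show 0 < r by omega)
    rw [div_le_iff₀ (by positivity)]
    have hx5 : x ^ 5 = x ^ 4 * t * t ^ 2 := by
      calc x ^ 5 = x ^ 4 * x := by ring
        _ = x ^ 4 * t ^ 3 := by rw [ht3]
        _ = x ^ 4 * t * t ^ 2 := by ring
    rw [hx5]
    have h4 : 4 * t ^ 2 ≤ (r : ℝ) ^ 2 := by nlinarith
    have h0 : 0 ≤ x ^ 4 * t := by positivity
    nlinarith [mul_le_mul_of_nonneg_left h4 h0]
  rw [h13]
  linarith

/-! ### The final inequality -/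

/-- **The numerical inequality closing Cafure–Matera's (22) for `δ ≥ 9`.** For `δ ≥ 9` and
`Q > 5δ^{10/3}`:
`(1 + δ + 4δ³)(Q - 1) + Q (δ² + ∑_{j=1}^{δ-1} min(c₃₂, e(⌊δ/(j+1)⌋))) ≤ 5δ^{13/3} (Q - 1)`.
(With `S ≤ 4δ^{13/3} + 2δ³` this reduces to `5δ^{13/3} + Q(6δ³ + δ² + 2δ + 1) ≤ Q δ^{13/3}`, and
`5δ^{13/3} < δ Q`, `δ^{13/3} ≥ 2δ⁴ ≥ 18δ³` for `δ ≥ 9`.)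
[cite: CafureMatera2006, proof of Thm. 5.2, (22)] -/
theorem numeric_main {δ : ℕ} (hδ : 9 ≤ δ) {Q : ℝ} (hQ : 5 * (δ : ℝ) ^ ((10 : ℝ) / 3) < Q) :
    ((1 : ℝ) + δ + 4 * (δ : ℝ) ^ 3) * (Q - 1) +
        Q * ((δ : ℝ) ^ 2 + ∑ j ∈ Finset.Icc 1 (δ - 1),
          min ((3 * (δ : ℝ) ^ 4 + 5 * (δ : ℝ) ^ 2) / 2 - 2 * (δ : ℝ) ^ 3)
            (2 * (δ : ℝ) ^ 2 + 2 * (δ : ℝ) ^ 2 * ((δ / (j + 1) : ℕ) : ℝ) *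
              (((δ / (j + 1) : ℕ) : ℝ) + 1) ^ 2)) ≤
      5 * (δ : ℝ) ^ ((13 : ℝ) / 3) * (Q - 1) := by
  set x : ℝ := (δ : ℝ) with hx
  have hx9 : (9 : ℝ) ≤ x := by rw [hx]; exact_mod_cast hδ
  have hx0 : 0 < x := by linarith
  set t : ℝ := x ^ ((3 : ℝ)⁻¹) with ht
  have ht0 : 0 < t := Real.rpow_pos_of_pos hx0 _
  have ht3 : t ^ 3 = x := rpow_third_pow_three hx0.le
  obtain ⟨h13, h10⟩ := rpow_thirteen_thirds_eq hx0
  rw [← ht] at h13 h10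
  -- `t > 2` since `t³ = x ≥ 9 > 8`
  have ht2 : 2 < t := by
    by_contra h
    rw [not_lt] at h
    have : t ^ 3 ≤ 2 ^ 3 := pow_le_pow_left₀ ht0.le h 3
    linarith
  have hS := sum_min_le_rpow (δ := δ) (by omega)
  rw [h13] at hS ⊢
  rw [h10] at hQ
  set S := ∑ j ∈ Finset.Icc 1 (δ - 1),
    min ((3 * (δ : ℝ) ^ 4 + 5 * (δ : ℝ) ^ 2) / 2 - 2 * (δ : ℝ) ^ 3)
      (2 * (δ : ℝ) ^ 2 + 2 * (δ : ℝ) ^ 2 * ((δ / (j + 1) : ℕ) : ℝ) *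
        (((δ / (j + 1) : ℕ) : ℝ) + 1) ^ 2) with hSdef
  have hS' : S ≤ 4 * (x ^ 4 * t) + 2 * x ^ 3 := hS
  have hQ0 : 0 < Q := lt_trans (by positivity) hQ
  -- `5 x⁴ t < x Q`
  have h5 : 5 * (x ^ 4 * t) < x * Q := by
    have := mul_lt_mul_of_pos_left hQ hx0
    linarith [show x * (5 * (x ^ 3 * t)) = 5 * (x ^ 4 * t) by ring]
  -- `x⁴ t ≥ 2 x⁴ ≥ 18 x³ ≥ 6x³ + x² + 2x + 1`
  have hbig : 6 * x ^ 3 + x ^ 2 + 2 * x + 1 ≤ x ^ 4 * t := by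
    have h1 : 2 * x ^ 4 ≤ x ^ 4 * t := by nlinarith [pow_pos hx0 4]
    have h2 : 18 * x ^ 3 ≤ 2 * x ^ 4 := by nlinarith [pow_pos hx0 3]
    nlinarith [pow_pos hx0 2, pow_pos hx0 3]
  -- assemble
  have hlow : 0 ≤ (1 : ℝ) + x + 4 * x ^ 3 := by positivity
  nlinarith [mul_le_mul_of_nonneg_left hS' hQ0.le, mul_le_mul_of_nonneg_left hbig hQ0.le]

end Literature.NumberTheory.DiophantineGeometry

end
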